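import Summits.Schanuel.Schanuel.Theorems.RootDecomp1KCollarWall01

/-!
# RootDecomp1KCollarWall — lens 1, generation 49, node 8 «THE COLLAR WALL: item 33364 decided hyp-free at the exhibited fixed-finite-order tuple z♮₃ = (1, ℓ₂, ρ♮₂) and its π-twin, via a class-level wall engine for DyadicCollarLiouville against any θ⃗ with MvPolyMeasure» — continuation (RootDecomp1KCollarWall02): §2 (W2) the balance and (W3) the collar wall engine

(lens-1 g49 HOME kernel K = HOME/decomp-schanuel-lens-1/g49/CollarWall.lean 402bd26b…, 1041 l, imports …RootDecomp1KCollarCell05 + …RootDecomp1KNWMeasureHolds BY NAME; P CollarWallProbe.lean / C CollarWallCtrl.lean; memo NODE-g49.md; CLAIM L2443, EX-ANTE PRICE + CHECKLIST K-g49 L2444, NODE L2450 / REQUEST L2451; critic VERDICT L2454: CLEARED AS PRICED — ONE CELL ×1 «COLLAR WALL», RULE K-R38, PORT GO. Port by census-1 gen 21 as `RootDecomp1KCollarWall01–05` along K's §1–§4 with §4 cut at its §4a/§4b sub-headers by the 400-line file cap: 01 = §1 (W1) `mvMaxval₂`, `clearPoly_ne_zero_of_twoAdic` — T1 in the `clearPoly`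 frame (the cleared θ-polynomial at 2-adically interlaced slots is ≠ 0); 02 = §2 (W2) `collar_balance_false` + (W3) **`algebraicIndependent_collar_of_mvPolyMeasure (hρ : DyadicCollarLiouville ρ) (hθ : MvPolyMeasure θ)`** — the COLLAR WALL ENGINE (resonant-height simultaneous specialisation against a transcendental block of polynomial measure); 03 = §3 (W4) the walls for the WHOLE class, hyp-free: `sb_collarWall3`, `sb_collarWall3_pi`, `finiteOrderLiouvilleSchanuel_collarWall3` (item 33364's binders verbatim + one range line), `finiteOrderLiouvilleSchanuel_collarWall3_pi`, `coordLiouvilleSchanuel_collarWall3`; 04 = §4a the ONE-CUT 2-adic linear-form bound at the member: `cutInt`, `cutInt_ne_zero`, `cut_height_bound`, **`form_lower_bound_N`**; 05 = §4b the tuples `zN3 = (1, ℓ₂, ρ♮₂)` / `zN3pi` with every binder of item 33364 certified hyp-free: `linearIndependent_zN3(pi)`, `linLiouville_zN3(pi)`, `not_hyperLinLiouville_zN3(pi)`, `sb_zN3` / `sb_zN3pi`, `finiteOrderLiouvilleSchanuel_at_zN3(pi)`, `item33364_at_zN3`, `rhoNat_two_position`. PORT EDITS (census convention): `set_option linter.dupNamespace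 false` dropped; per-part private helper copies if any; statements and proofs otherwise verbatim (no renames; K's own private markers kept). `--supports stmt-Schanuel-33364`; no census credit carried; rung 0 — nothing here proves Schanuel; no ∀-item moves; 33364, 33363, 31077 stay OPEN.)
-/

noncomputable section

open Polynomial LiouvilleNumber
open scoped Nat

namespace Summit.Schanuel.Schanuel.Theorems.RootDecomp1KCollarWall

open Summit.Schanuel.Schanuel.Theorems.RootDecomp1KCollarCell
open Summit.Schanuel.Schanuel.Theorems.RootDecomp1KGapCell
open Summit.Schanuel.Schanuel.Theorems.RootDecomp1KTwoBaseCell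
open Summit.Schanuel.Schanuel.Theorems.RootDecomp1KRelLiouvilleCell
open Summit.Schanuel.Schanuel.Theorems.RootDecomp1KNWMeasureHolds (nwMeasure_holds polyMeasure_exp_one_holds)
open Summit.Schanuel.Schanuel.Theorems.RootDecomp1KHyper
open Summit.Schanuel.Schanuel.Theorems.RootDecomp1KHyper.HyperCell

/-! ## §2  (W2) the balance and (W3) THE COLLAR WALL ENGINE -/
section Engine
variable {n : ℕ}

/-- **(W2) the final balance** (pure bookkeeping in powers of `2`; every numeric side condition an explicit hypothesis):
the measure's lower bound `1 ≤ A₀ · D^{τ+1} · δ` is impossible when `D ≤ 2^{3dN!}`,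
`δ ≤ 2/2^{(N+1)!} + 1/2^{(N!+h)·A}`, `3d(τ+1) + 1 ≤ A`, `3d(τ+1) + 2 ≤ N` and `3A₀ < 2^K`, `K ≤ N`. -/
theorem collar_balance_false {A₀ D δ : ℝ} {d τ N h A K : ℕ} (hA₀0 : 0 ≤ A₀) (hD0 : 0 < D) (hδ0 : 0 ≤ δ)
    (h1 : 1 ≤ A₀ * D ^ (τ + 1) * δ) (hD_le : D ≤ (2 : ℝ) ^ (3 * d * N !))
    (hδ_le : δ ≤ 2 / (2 : ℝ) ^ (N + 1)! + 1 / (2 : ℝ) ^ ((N ! + h) * A))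
    (hA : 3 * d * (τ + 1) + 1 ≤ A) (hN : 3 * d * (τ + 1) + 2 ≤ N) (hK : 3 * A₀ < (2 : ℝ) ^ K)
    (hKN : K ≤ N) : False := by
  set E : ℕ := 3 * d * N ! * (τ + 1) with hE
  have hDpow : D ^ (τ + 1) ≤ (2 : ℝ) ^ E := by
    calc D ^ (τ + 1) ≤ ((2 : ℝ) ^ (3 * d * N !)) ^ (τ + 1) := pow_le_pow_left₀ hD0.le hD_le _
      _ = (2 : ℝ) ^ E := by rw [← pow_mul]
  have hNf : N ≤ N ! := Nat.self_le_factorial N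
  have hf1 : 1 ≤ N ! := Nat.factorial_pos N
  -- exponent bookkeeping
  have e1 : E + 1 + K ≤ (N + 1)! := by
    have h3 : (3 * d * (τ + 1) + 3) * N ! ≤ (N + 1) * N ! := Nat.mul_le_mul_right _ (by omega)
    have h4 : (3 * d * (τ + 1) + 3) * N ! = E + 3 * N ! := by rw [hE]; ring
    rw [Nat.factorial_succ]; omega
  have e2 : E + K ≤ (N ! + h) * A := by
    have h3 : N ! * (3 * d * (τ + 1) + 1) ≤ (N ! + h) * A := Nat.mul_le_mul (Nat.le_add_right _ _) hA
    have h4 : N ! * (3 * d * (τ + 1) + 1) = E + N ! := by rw [hE]; ring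
    omega
  have h2pos : ∀ m : ℕ, (0 : ℝ) < (2 : ℝ) ^ m := fun m => by positivity
  have hpow1 : (2 : ℝ) ^ E * (2 / (2 : ℝ) ^ (N + 1)!) ≤ 1 / (2 : ℝ) ^ K := by
    have e3 : (2 : ℝ) ^ E * (2 / (2 : ℝ) ^ (N + 1)!) = (2 : ℝ) ^ (E + 1) / (2 : ℝ) ^ (N + 1)! := by
      rw [pow_succ]; ring
    rw [e3, div_le_div_iff₀ (h2pos _) (h2pos _), one_mul, ← pow_add]
    exact pow_le_pow_right₀ (by norm_num) e1
  have hpow2 : (2 : ℝ) ^ E * (1 / (2 : ℝ) ^ ((N ! + h) * A)) ≤ 1 / (2 : ℝ) ^ K := by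
    rw [mul_one_div, div_le_div_iff₀ (h2pos _) (h2pos _), one_mul, ← pow_add]
    exact pow_le_pow_right₀ (by norm_num) e2
  have hK0 : (0 : ℝ) < (2 : ℝ) ^ K := h2pos K
  have hkey : A₀ * D ^ (τ + 1) * δ ≤ A₀ * (2 / (2 : ℝ) ^ K) := by
    have hstep : D ^ (τ + 1) * δ ≤ (2 : ℝ) ^ E * (2 / (2 : ℝ) ^ (N + 1)! + 1 / (2 : ℝ) ^ ((N ! + h) * A)) :=
      mul_le_mul hDpow hδ_le hδ0 (h2pos E).le
    have hstep2 : (2 : ℝ) ^ E * (2 / (2 : ℝ) ^ (N + 1)! + 1 / (2 : ℝ) ^ ((N ! + h) * A)) ≤ 2 / (2 : ℝ) ^ K := by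
      rw [mul_add]
      have : 1 / (2 : ℝ) ^ K + 1 / (2 : ℝ) ^ K = 2 / (2 : ℝ) ^ K := by ring
      linarith
    calc A₀ * D ^ (τ + 1) * δ = A₀ * (D ^ (τ + 1) * δ) := by ring
      _ ≤ A₀ * (2 / (2 : ℝ) ^ K) := mul_le_mul_of_nonneg_left (hstep.trans hstep2) hA₀0
  have hlt : A₀ * (2 / (2 : ℝ) ^ K) < 1 := by
    rw [mul_div_assoc', div_lt_one hK0]; linarith
  linarith

/-- **(W3) THE COLLAR WALL ENGINE.**  A dyadic-collar-Liouville real `ρ` (tree CollarCell02 `DyadicCollarLiouville`: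
ORDER + 2-ADIC LOCATION data only) and a tuple `θ⃗` with a polynomial measure of algebraic independence in every degree
(tree Hyper03 `MvPolyMeasure θ`): then `(ρ, ℓ₂, θ_1, …, θ_n)` is algebraically independent over `ℚ`.
SIMULTANEOUS specialisation at RESONANT heights — `ρ` at its collar approximant `t = M/2^{N!+h}`, `ℓ₂` at its truncation
`s_N = p_N/2^{N!}` (`M`, `p_N` odd): the cleared `θ`-polynomial `H = D·P(t, s_N, X_θ⃗)` is `≠ 0` by (W1) (2-adic
interlacing; `h > maxval₂`, `N! > d·h + maxval₂` from the collar with `A := 3d(τ+1) + d + maxval₂ + 1`), the measure of `θ⃗`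
bounds `‖H(θ⃗)‖` below, Lipschitz bounds it above by `D·L·d·R^d·δ`, `δ = 2/2^{(N+1)!} + den(t)^{−A}`, and (W2) closes:
the collar headroom `(N+1)! ≥ (3d(τ+1)+3)·N!`, `den(t)^A ≥ 2^{N!·A}` absorbs the measure loss `C·len(H)^τ ≤ A₀·2^{3d(τ+1)N!}`.
Proof skeleton = tree GapCell03 `algebraicIndependent_gap_of_mvPolyMeasure` (its parts `algebraicIndependent_of_forall_int'`,
`aeval_clearPoly`, `totalDegree_clearPoly_le`, `mvlen_clearPoly_le`, `norm_aeval_sub_aeval_le`, `exists_threshold` BY NAME);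
the gap step (`clearPoly_ne_zero_of_gap`, Lemma A) is REPLACED by (W1) and `gap_balance_false` by (W2).  NO induced measure
of `(ℓ₂, θ⃗)` or `(ρ, θ⃗)` is formed (collar approximants have only polynomial quality `den^{−A}`). -/
theorem algebraicIndependent_collar_of_mvPolyMeasure {ρ : ℝ} (hρ : DyadicCollarLiouville ρ)
    {θ : Fin n → ℂ} (hθ : MvPolyMeasure θ) :
    AlgebraicIndependent ℚ
      (Sum.elim (Fin.cons (ρ : ℂ) (fun _ : Fin 1 => ((liouvilleNumber 2 : ℝ) : ℂ)) : Fin (1 + 1) → ℂ) θ :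
        Fin (1 + 1) ⊕ Fin n → ℂ) := by
  classical
  refine algebraicIndependent_of_forall_int' fun P hP0 hPval => ?_
  -- degree and measure
  set d : ℕ := P.totalDegree with hd
  obtain ⟨C, τ, hC, hmeas⟩ := hθ d
  have hdeg : ∀ e ∈ P.support, ∑ x, e x ≤ d := fun e he => by
    have h1 := MvPolynomial.le_totalDegree he
    rwa [Finsupp.sum_fintype _ _ (fun _ => rfl)] at h1
  have hdegl : ∀ e ∈ P.support, ∀ i, e (Sum.inl i) ≤ d := fun e he i => by
    refine le_trans ?_ (hdeg e he)
    exact Finset.single_le_sum (f := fun x => e x) (fun _ _ => Nat.zero_le _) (Finset.mem_univ _)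
  have hdegL : ∀ e ∈ P.support, ∑ i, e (Sum.inl i) ≤ d := fun e he => by
    refine le_trans ?_ (hdeg e he)
    rw [Fintype.sum_sum_type]; exact Nat.le_add_right _ _
  have hdegT : ∀ e ∈ P.support, ∑ j, e (Sum.inr j) ≤ d := fun e he => by
    refine le_trans ?_ (hdeg e he)
    rw [Fintype.sum_sum_type]; exact Nat.le_add_left _ _
  -- (b) constants
  set V : ℕ := mvMaxval₂ P with hV
  set L : ℝ := ∑ e ∈ P.support, |((P.coeff e : ℤ) : ℝ)| with hL
  have hL0 : 0 ≤ L := Finset.sum_nonneg fun _ _ => abs_nonneg _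
  set Rb : ℝ := 2 + |ρ| with hRb
  have hρabs : 0 ≤ |ρ| := abs_nonneg ρ
  have hRb2 : 2 ≤ Rb := by linarith
  have hRb1 : 1 ≤ Rb := by linarith
  set R : ℝ := Rb + ∑ j, ‖θ j‖ with hR
  have hθsum : 0 ≤ ∑ j, ‖θ j‖ := Finset.sum_nonneg fun _ _ => norm_nonneg _
  have hR1 : 1 ≤ R := by linarith
  have hRbR : Rb ≤ R := by linarith
  have hθR : ∀ j, ‖θ j‖ ≤ R := fun j => by
    have : ‖θ j‖ ≤ ∑ j, ‖θ j‖ :=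
      Finset.single_le_sum (f := fun j => ‖θ j‖) (fun _ _ => norm_nonneg _) (Finset.mem_univ j)
    linarith
  set A : ℕ := 3 * d * (τ + 1) + d + V + 1 with hA
  set A₀ : ℝ := C * (Rb ^ d * L) ^ τ * (L * (d * R ^ d)) with hA₀
  have hA₀0 : 0 ≤ A₀ := by positivity
  -- (c) the threshold `K` (tree `exists_threshold`), then the scale `N`, the collar width `h` and the approximant `t`
  obtain ⟨K, hKN₀, -, hKA⟩ := exists_threshold (3 * d * (τ + 1) + 2) 0 (3 * A₀)
  obtain ⟨N, hKN, h, hAh, hAhN, t, htden, hlt⟩ := hρ A K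
  have hN2 : 2 ≤ N := by omega
  have hh1 : 1 ≤ h := le_trans (by omega) hAh
  have hhV : V < h := lt_of_lt_of_le (by omega) hAh
  have hFV : d * h + V < N ! := by
    have h3 : (d + V + 1) * h ≤ A * h := Nat.mul_le_mul_right h (by omega)
    have h4 : (d + V + 1) * h = d * h + (V + 1) * h := by ring
    have h5 : V + 1 ≤ (V + 1) * h := Nat.le_mul_of_pos_right _ hh1
    omega
  have hhN : h ≤ N ! := by
    have hA1 : 1 ≤ A := by omega
    calc h = 1 * h := (one_mul h).symm
      _ ≤ A * h := Nat.mul_le_mul_right h hA1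
      _ ≤ N ! := hAhN
  -- the approximant `t = M / 2^{N!+h}`, `M` odd
  set Q : ℝ := (t.den : ℝ) with hQ
  have hQ2 : Q = (2 : ℝ) ^ (N ! + h) := by rw [hQ, htden]; push_cast; rfl
  have hQpos : 0 < Q := by rw [hQ]; exact_mod_cast t.den_pos
  have hQ1 : 1 ≤ Q := by rw [hQ]; exact_mod_cast Nat.one_le_iff_ne_zero.mpr t.den_nz
  set M : ℤ := t.num with hM
  have hModd : Odd M := odd_num_of_den_two_pow (E := N ! + h) (by omega) htden
  have ht_eq : (t : ℝ) = (M : ℝ) / Q := by rw [hQ, hM, Rat.cast_def]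
  have hQA0 : 0 < Q ^ A := pow_pos hQpos _
  have hQA1 : 1 / Q ^ A ≤ 1 := by
    rw [div_le_one hQA0]; exact one_le_pow₀ hQ1
  have hρt1 : |ρ - t| ≤ 1 := (hlt.le).trans hQA1
  have ht_abs : |(t : ℝ)| ≤ |ρ| + 1 := by
    have := abs_sub_abs_le_abs_sub (t : ℝ) ρ
    rw [abs_sub_comm] at this
    linarith
  have hM_abs : |(M : ℝ)| ≤ Rb * Q := by
    have e1 : |(M : ℝ)| = |(t : ℝ)| * Q := by
      rw [ht_eq, abs_div, abs_of_pos hQpos, div_mul_cancel₀ _ hQpos.ne']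
    rw [e1]
    refine mul_le_mul_of_nonneg_right ?_ hQpos.le
    linarith
  -- (d) the truncation `s_N = p_N / 2^{N!}` of `ℓ₂`, `p_N` odd
  set s : ℝ := partialSum 2 N with hs
  set pN : ℤ := ((psNumer 2 N : ℕ) : ℤ) with hpN
  have hpodd : Odd pN := odd_psNumer_two hN2
  have hsp : s = (pN : ℝ) / (((2 : ℤ) ^ N ! : ℤ) : ℝ) := by
    have := partialSum_eq_psNumer_div (b := 2) two_pos N
    rw [hs, hpN]; push_cast at this ⊢; exact this
  have hpN_lt : psNumer 2 N < 2 * 2 ^ N ! := by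
    have := RootDecomp1KOnePointCell.psNumer_lt_two_mul (b := 2) (le_refl 2) N
    push_cast at this
    exact_mod_cast this
  have hpN_abs : |(pN : ℝ)| ≤ Rb * (((2 : ℤ) ^ N ! : ℤ) : ℝ) := by
    rw [hpN]; push_cast
    rw [abs_of_nonneg (by positivity)]
    have h1 : ((psNumer 2 N : ℕ) : ℝ) ≤ 2 * (2 : ℝ) ^ N ! := by exact_mod_cast hpN_lt.le
    calc ((psNumer 2 N : ℕ) : ℝ) ≤ 2 * (2 : ℝ) ^ N ! := h1
      _ ≤ Rb * (2 : ℝ) ^ N ! := mul_le_mul_of_nonneg_right hRb2 (by positivity)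
  have hs_pos : 0 < s := partialSum_two_pos N
  have hs_lt : s < 2 := by
    have h1 := partialSum_two_lt_liouvilleNumber N
    have h2 := liouvilleNumber_two_lt
    rw [hs]; linarith
  have hℓ_pos : 0 < liouvilleNumber 2 := liouvilleNumber_two_pos
  have hℓ_lt : liouvilleNumber 2 < 2 := by have := liouvilleNumber_two_lt; linarith
  have hdiff : |s - liouvilleNumber 2| ≤ 2 / (2 : ℝ) ^ (N + 1)! := by
    rw [abs_sub_comm]; exact (abs_liouvilleNumber_two_sub_partialSum N).le
  -- (d') the specialised side on `Fin (1+1)`: slot `0` is `ρ ↦ t`, slot `1` is `ℓ₂ ↦ s_N`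
  set s' : Fin (1 + 1) → ℝ := Fin.cons (t : ℝ) (fun _ => s) with hs'
  set ℓ' : Fin (1 + 1) → ℝ := Fin.cons ρ (fun _ => liouvilleNumber 2) with hℓ'
  set p' : Fin (1 + 1) → ℤ := Fin.cons M (fun _ => pN) with hp'
  set B' : Fin (1 + 1) → ℤ := Fin.cons ((2 : ℤ) ^ (N ! + h)) (fun _ => (2 : ℤ) ^ N !) with hB'
  have hB'pos : ∀ i, (0 : ℝ) < B' i := fun i => by
    refine Fin.cases ?_ (fun j => ?_) i
    · simp only [hB', Fin.cons_zero]; push_cast; positivity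
    · simp only [hB', Fin.cons_succ]; push_cast; positivity
  have hsp' : ∀ i, s' i = (p' i : ℝ) / (B' i : ℝ) := fun i => by
    refine Fin.cases ?_ (fun j => ?_) i
    · simp only [hs', hp', hB', Fin.cons_zero]; rw [ht_eq, hQ2]; push_cast; rfl
    · simp only [hs', hp', hB', Fin.cons_succ]; exact hsp
  have hp'_abs : ∀ i, |(p' i : ℝ)| ≤ Rb * B' i := fun i => by
    refine Fin.cases ?_ (fun j => ?_) i
    · simp only [hp', hB', Fin.cons_zero]
      have : (((2 : ℤ) ^ (N ! + h) : ℤ) : ℝ) = Q := by rw [hQ2]; push_cast; rfl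
      rw [this]; exact hM_abs
    · simp only [hp', hB', Fin.cons_succ]; exact hpN_abs
  have hs'_abs : ∀ i, |s' i| ≤ Rb := fun i => by
    refine Fin.cases ?_ (fun j => ?_) i
    · simp only [hs', Fin.cons_zero]; linarith
    · simp only [hs', Fin.cons_succ]; rw [abs_of_pos hs_pos]; linarith
  have hℓ'_abs : ∀ i, |ℓ' i| ≤ Rb := fun i => by
    refine Fin.cases ?_ (fun j => ?_) i
    · simp only [hℓ', Fin.cons_zero]; linarith
    · simp only [hℓ', Fin.cons_succ]; rw [abs_of_pos hℓ_pos]; linarith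
  set δ : ℝ := 2 / (2 : ℝ) ^ (N + 1)! + 1 / Q ^ A with hδ
  have hQAinv : (0 : ℝ) ≤ 1 / Q ^ A := (div_pos one_pos hQA0).le
  have h2fac : (0 : ℝ) ≤ 2 / (2 : ℝ) ^ (N + 1)! := by positivity
  have hδ0 : 0 ≤ δ := by rw [hδ]; linarith
  have hdiff' : ∀ i, |s' i - ℓ' i| ≤ δ := fun i => by
    refine Fin.cases ?_ (fun j => ?_) i
    · simp only [hs', hℓ', Fin.cons_zero]
      rw [abs_sub_comm]
      linarith [hlt.le]
    · simp only [hs', hℓ', Fin.cons_succ]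
      linarith [hdiff]
  -- (e) the integer polynomial `H = D · P(s', X)` in the `θ`-variables (tree `clearPoly`): value, degree, length
  set H : MvPolynomial (Fin n) ℤ := clearPoly P d p' B' with hH
  set D : ℝ := ∏ i, ((B' i : ℤ) : ℝ) ^ d with hD
  have hD0 : 0 < D := Finset.prod_pos fun i _ => pow_pos (hB'pos i) _
  set xs : Fin (1 + 1) ⊕ Fin n → ℂ := Sum.elim (fun i => ((s' i : ℝ) : ℂ)) θ with hxs
  set xl : Fin (1 + 1) ⊕ Fin n → ℂ := Sum.elim (fun i => ((ℓ' i : ℝ) : ℂ)) θ with hxl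
  have hxl_eq : xl = Sum.elim (Fin.cons (ρ : ℂ) (fun _ : Fin 1 => ((liouvilleNumber 2 : ℝ) : ℂ)) :
      Fin (1 + 1) → ℂ) θ := by
    funext x
    rcases x with i | j
    · simp only [hxl, Sum.elim_inl]
      refine Fin.cases ?_ (fun i' => ?_) i
      · simp [hℓ']
      · simp [hℓ']
    · simp [hxl]
  have hHval : MvPolynomial.aeval θ H = (D : ℂ) * MvPolynomial.aeval xs P :=
    aeval_clearPoly hdegl hB'pos hsp' θ
  have hHdeg : H.totalDegree ≤ d := totalDegree_clearPoly_le hdegT p' B'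
  have hHlen : (mvlen H : ℝ) ≤ Rb ^ d * D * L := mvlen_clearPoly_le hdegl hdegL hB'pos hRb1 hp'_abs
  have hHlen0 : (0 : ℝ) ≤ mvlen H := by exact_mod_cast mvlen_nonneg H
  -- (e3) `H ≠ 0` by (W1): 2-adic interlacing at the resonant heights
  have hH0 : H ≠ 0 := by
    rw [hH, hp', hB']
    exact clearPoly_ne_zero_of_twoAdic hP0 hdegl (F := N !) (h := h) hModd hpodd hhV hFV
  -- (f) the measure at `H`
  have hMeas := hmeas H hH0 hHdeg
  rw [hHval, norm_mul, Complex.norm_real, Real.norm_eq_abs, abs_of_pos hD0] at hMeas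
  -- (g) the Lipschitz upper bound `‖P(s', θ)‖ = ‖P(s', θ) − P(ℓ', θ)‖ ≤ L d R^d δ`
  have hval0 : MvPolynomial.aeval xl P = 0 := by rw [hxl_eq]; exact hPval
  have hx : ∀ x, ‖xs x‖ ≤ R := by
    intro x; cases x with
    | inl i => simp only [hxs, Sum.elim_inl, Complex.norm_real, Real.norm_eq_abs]
               exact (hs'_abs i).trans hRbR
    | inr j => simp only [hxs, Sum.elim_inr]; exact hθR j
  have hy : ∀ x, ‖xl x‖ ≤ R := by
    intro x; cases x with
    | inl i => simp only [hxl, Sum.elim_inl, Complex.norm_real, Real.norm_eq_abs]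
               exact (hℓ'_abs i).trans hRbR
    | inr j => simp only [hxl, Sum.elim_inr]; exact hθR j
  have hxy : ∀ x, ‖xs x - xl x‖ ≤ δ := by
    intro x; cases x with
    | inl i => simp only [hxs, hxl, Sum.elim_inl]
               rw [← Complex.ofReal_sub, Complex.norm_real, Real.norm_eq_abs]; exact hdiff' i
    | inr j => simp only [hxs, hxl, Sum.elim_inr, sub_self, norm_zero]; exact hδ0
  have hLip := norm_aeval_sub_aeval_le P hR1 hδ0 hx hy hxy (le_refl d)
  rw [hval0, sub_zero] at hLip
  -- (h) combine: `1 ≤ A₀ · D^{τ+1} · δ` against (W2)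
  have h1 : (1 : ℝ) ≤ A₀ * D ^ (τ + 1) * δ := by
    have h1' : (1 : ℝ) ≤ C * (Rb ^ d * D * L) ^ τ * (D * (L * (d * R ^ d * δ))) := by
      calc (1 : ℝ) ≤ C * (mvlen H : ℝ) ^ τ * (D * ‖MvPolynomial.aeval xs P‖) := hMeas
        _ ≤ C * (Rb ^ d * D * L) ^ τ * (D * ‖MvPolynomial.aeval xs P‖) := by gcongr
        _ ≤ C * (Rb ^ d * D * L) ^ τ * (D * (L * (d * R ^ d * δ))) := by gcongr
    have h2 : C * (Rb ^ d * D * L) ^ τ * (D * (L * (d * R ^ d * δ))) = A₀ * D ^ (τ + 1) * δ := by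
      rw [hA₀]; ring
    exact h1'.trans_eq h2
  have hD_eq : D = (2 : ℝ) ^ ((N ! + h) * d + N ! * d) := by
    rw [hD, Fin.prod_univ_succ, Fin.prod_univ_one]
    simp only [hB', Fin.cons_zero, Fin.cons_succ]
    push_cast
    rw [← pow_mul, ← pow_mul, ← pow_add]
  have hD_le : D ≤ (2 : ℝ) ^ (3 * d * N !) := by
    rw [hD_eq]
    refine pow_le_pow_right₀ (by norm_num) ?_
    have : (N ! + h) * d + N ! * d ≤ (N ! + N !) * d + N ! * d :=
      Nat.add_le_add_right (Nat.mul_le_mul_right d (Nat.add_le_add_left hhN _)) _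
    refine this.trans (le_of_eq ?_); ring
  have hδ_le : δ ≤ 2 / (2 : ℝ) ^ (N + 1)! + 1 / (2 : ℝ) ^ ((N ! + h) * A) := by
    rw [hδ, hQ2, ← pow_mul]
  exact collar_balance_false hA₀0 hD0 hδ0 h1 hD_le hδ_le (by omega) (by omega) hKA hKN

end Engine

end Summit.Schanuel.Schanuel.Theorems.RootDecomp1KCollarWall

end
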